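import Literature.AnabelianGeometry.EtaleTheta.Discharge.Sec3Cor38Criterion
import HarnessLib

/-!
# [EtTh] Definition 3.6 (ii)(b), bracketed sentence — the binder `hNZ` of row C38-L05 REDUCED to
# properties of the Def. 3.6 (i) data (cell GAP-LEDGER row G-w5d124-2)

Mochizuki, *The étale theta function …*, Publ. RIMS **45** (2009), Def. 3.6 (ii)(b), printed p.303
(PDF p.77) l.8–10 [cite: MochizukiEtTh2009, Def 3.6 p.77]:

> "(b) the image of the resulting homomorphism of group-like monoids on `D`
> `F := F₀^Λ|_D ×_{(Φ^{ℝ-log})^gp} Φ^gp → (Φ^{bs-fld})^gp (⊆ (Φ^{ℝ-log})^gp)` determines a subfunctor in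
> nonzero monoids of `(Φ^{bs-fld})^gp` [i.e., for every `A ∈ Ob(D)`, the homomorphism
> `F(A) → (Φ^{bs-fld})^gp(A)` is nonzero]. [Thus, it follows from these conditions that for every
> `A ∈ Ob(D)`, the image of the homomorphism `F(A) → (Φ^{bs-fld})^gp(A)` contains a nonzero element of
> `Φ^{bs-fld}(A)`.]"

abc-iut cell, layer L2, seat abc-iut-w4-d008 (gen 3); proof-only companion (0 defs) of
`TemperedFrobenioid.lean` (abc-iut-L2-t3) and of `Discharge/Sec3Cor38Criterion.lean` (abc-iut-w5-d124,
p422576), whose closing theorem `bsFldPreStepLimitCriterion_of` (row C38-L05 of the Cor. 3.8 sub-DAG) carries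
the bracketed sentence VERBATIM as the binder `hNZ`.  The typed condition (b) (`exists_FΛ_div_ne`: a constant
`b ∈ F₀^Λ(Y_A)` with divisor `x/y`, `x ≠ y ∈ Φ(A)`) does NOT by itself give `hNZ` over the typed structure
(kernel certificate: `TemperedFrobenioidToyHNZ.lean`, `ToyHNZ.hNZ_not_derivable`).  Print's "it follows"
uses two properties of the Def. 3.6 (i) DATA that `RealifiedDivisorMonoids` (v2) leaves unrecorded:

* `hLine` — every element of `ℝ·Φ₀^cnst(Y) ⊆ (Φ₀^ℝ)^gp(Y)` is EFFECTIVE or ANTI-EFFECTIVE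
  (print: `ℝ·Φ₀^cnst(Y) = ℝ·div(ϖ_L)` is the real line through the — effective — divisor of a uniformiser,
  Prop. 3.4 (ii) third isomorphism `L^× ⥲ F₀(Y)`, p.300; inside the `ℝ`-vector space `(Φ₀^rlf)^gp`,
  [FrdI] Def. 2.4 (i));
* `hInt` — `Φ₀^ℝ(Y) = Φ₀(Y)^rlf` is integral (cancellative): a submonoid of `∏_𝔭 ℝ_{≥0}` ([FrdI] Def. 2.4 (i)(c));

and ONE of: `hP34Λ` — Prop. 3.4 (ii) second isomorphism at monoid type `Λ` ("an element of `B₀^Λ(Y)` with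
effective divisor is constant"; the binder of G-w5d124-1, ALREADY carried by `bsFldPreStepLimitCriterion_of`),
or `hFinv` — `F₀^Λ(Y)` is inverse-closed (print: `F₀(Y) ≅ L^×` is a group).  The third input is genuinely
needed: with `hLine ∧ hInt` alone `hNZ` still fails (`TemperedFrobenioidToyHNZ.lean`, `ToyHNZ₂`).

Proof (print's one line, p.303): take the constant `b` of (b) with `div(b) = x/y ∈ ℝ·Φ₀^cnst`; by `hLine`
`x/y = r^{±1}` with `r` effective; by `hInt` `x = r·y` (resp. `y = r·x`), so `r ∈ Φ(A)` by group-saturation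
of `Φ ⊆ Φ^{ℝ-log}` and `r ≠ 1`; in the `+` case `(b, r)` is the wanted constant, in the `−` case `(b⁻¹, r)`
(`B₀^Λ` group-like: `isUnit_BΛ`), `b⁻¹ ∈ F₀^Λ` by `hP34Λ` (resp. `hFinv`).

Main declarations: `TemperedFrobenioid.exists_cnstFn_effective_of_line` (= `hNZ` from `hLine hInt hP34Λ`),
`…_of_line_of_inv` (from `hLine hInt hFinv`), and the re-export
`TemperedFrobenioid.bsFldPreStepLimitCriterion_of_line` of row C38-L05 whose binder list
`{hP34Λ, hLine, hInt, hSup}` now consists of properties of the Def. 3.3 (iii)/3.6 (i) data ALONE.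
HONEST FRAMING: refereed pre-IUT material ([EtTh] §3); nothing here bears on [IUTchIII] Cor. 3.12;
typed ≠ proved for the rest of §3.
-/

namespace Literature.AnabelianGeometry.EtaleTheta

open CategoryTheory Opposite Limits Literature.AlgebraicGeometry.Frobenioids

universe u₀ v₀ u v w

variable {D₀ : Type u₀} [Category.{v₀} D₀] {V : FrdIMonoidStub.{w}}
  {T : RealifiedDivisorMonoids (D₀ := D₀) V} {D : Type u} [Category.{v} D] {VD : FrdICatStub.{u, v, w} D}

/-! ### §0 Three lines of algebra in the Grothendieck group of an integral monoid -/

section Integral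

variable {M : Type*} [CommMonoid M]

/-- In an integral monoid, `r = x/y` in `M^gp` forces `x = r·y`. [folklore] -/
private theorem eq_mul_of_of_eq_div (hM : IsCancelMul M) {x y r : M}
    (h : Algebra.GrothendieckGroup.of r = Algebra.GrothendieckGroup.of x / Algebra.GrothendieckGroup.of y) :
    x = r * y := by
  haveI := hM
  apply Algebra.GrothendieckGroup.of_injective
  rw [map_mul, h, div_mul_cancel]

/-- In an integral monoid, `r⁻¹ = x/y` in `M^gp` forces `y = r·x`. [folklore] -/
private theorem eq_mul_of_of_inv_eq_div (hM : IsCancelMul M) {x y r : M}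
    (h : (Algebra.GrothendieckGroup.of r)⁻¹ = Algebra.GrothendieckGroup.of x / Algebra.GrothendieckGroup.of y) :
    y = r * x := by
  haveI := hM
  apply Algebra.GrothendieckGroup.of_injective
  rw [map_mul, ← inv_inv (Algebra.GrothendieckGroup.of r), h, inv_div, div_mul_cancel]

/-- `x = r·y` with `x ≠ y` forces `r ≠ 1`. [folklore] -/
private theorem ne_one_of_eq_mul_of_ne {x y r : M} (h : x = r * y) (hxy : x ≠ y) : r ≠ 1 := by
  rintro rfl
  exact hxy (by rw [h, one_mul])

end Integral

namespace TemperedFrobenioid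

variable (C : TemperedFrobenioid T D VD)

/-! ### §1 Bookkeeping: a constant with a nontrivial EFFECTIVE divisor is an `hNZ`-witness -/

/-- If a constant `b ∈ F₀^Λ(Y_A)` has divisor `div(b) = Z` for an element `Z ≠ 1` of `Φ(A)`, then the pair
`(b, Z) ∈ F(A) = F₀^Λ|_D ×_{(Φ^{ℝ-log})^gp} Φ^gp` is an element of `F(A)` whose image in `(Φ^{bs-fld})^gp(A)` is the
nonzero element `Z` — the shape of the bracketed sentence of Def. 3.6 (ii)(b) (the binder `hNZ` of
`bsFldPreStepLimitCriterion_of`, VERBATIM). [cite: MochizukiEtTh2009, Def 3.6 p.77] -/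
theorem exists_cnstFn_effective_of_divΛ_eq {A : Dᵒᵖ} {b : T.BΛ.obj (C.baseOp A)}
    (hb : b ∈ T.FΛ (C.baseOp A)) {Z : C.Φ.carrier A} (hZ : Z ≠ 1)
    (h : T.divΛ _ b = Algebra.GrothendieckGroup.of (Z : C.ΦRlog.obj A)) :
    ∃ u : (T.BΛ.obj (C.baseOp A) : Type w) × Algebra.GrothendieckGroup (C.Φ.carrier A),
      u ∈ C.cnstFn A ∧ ∃ Z : C.Φ.carrier A, Z ≠ 1 ∧ u.2 = Algebra.GrothendieckGroup.of Z := by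
  refine ⟨⟨b, Algebra.GrothendieckGroup.of Z⟩, Submonoid.mem_inf.2 ⟨?_, ?_⟩, Z, hZ, rfl⟩
  · change T.divΛ (C.baseOp A) b = C.ΦgpToRlog A (Algebra.GrothendieckGroup.of Z)
    rw [h, ΦgpToRlog, gpMap_of]
    rfl
  · exact hb

/-! ### §2 The reduction: `hNZ` from (b) + LINE + integrality + one closure property of `F₀^Λ` -/

/-- **Core of print's "it follows from these conditions"** (Def. 3.6 (ii)(b), p.303 l.8–10): `hNZ` holds at
every `A ∈ Ob(D)` provided (1) `hLine`: every element of `ℝ·Φ₀^cnst(Y)` is effective or anti-effective in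
`(Φ₀^ℝ)^gp(Y)`, (2) `hInt`: `Φ₀^ℝ(Y)` is integral, and (3) `hNeg`: a constant of `F₀^Λ(Y)` with ANTI-effective
divisor `r⁻¹` has a companion constant in `F₀^Λ(Y)` with divisor `r`.  Uses only the typed fields
`exists_FΛ_div_ne` (condition (b)), `divΛ_mem_cnstR` and the group-saturation of `Φ ⊆ Φ^{ℝ-log}`.
[cite: MochizukiEtTh2009, Def 3.6 p.77] -/
theorem exists_cnstFn_effective_of_line_aux
    (hLine : ∀ (Y : D₀ᵒᵖ) (g : Algebra.GrothendieckGroup (T.ΦR.obj Y)), g ∈ T.cnstR Y →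
      ∃ r : T.ΦR.obj Y, g = Algebra.GrothendieckGroup.of r ∨ g = (Algebra.GrothendieckGroup.of r)⁻¹)
    (hInt : ∀ Y : D₀ᵒᵖ, IsCancelMul (T.ΦR.obj Y))
    (hNeg : ∀ (Y : D₀ᵒᵖ) (b : T.BΛ.obj Y), b ∈ T.FΛ Y → ∀ r : T.ΦR.obj Y,
      T.divΛ Y b = (Algebra.GrothendieckGroup.of r)⁻¹ →
        ∃ b' ∈ T.FΛ Y, T.divΛ Y b' = Algebra.GrothendieckGroup.of r)
    (A : Dᵒᵖ) :
    ∃ u : (T.BΛ.obj (C.baseOp A) : Type w) × Algebra.GrothendieckGroup (C.Φ.carrier A),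
      u ∈ C.cnstFn A ∧ ∃ Z : C.Φ.carrier A, Z ≠ 1 ∧ u.2 = Algebra.GrothendieckGroup.of Z := by
  obtain ⟨b, hb, x, hx, y, hy, hxy, hdiv⟩ := C.exists_FΛ_div_ne A
  have hmem : T.divΛ _ b ∈ T.cnstR (C.baseOp A) := T.divΛ_mem_cnstR _ b hb
  obtain ⟨r, hr | hr⟩ := hLine _ _ hmem
  · -- `div(b) = r` effective: `x = r·y`, so `r ∈ Φ(A)` and `(b, r)` is the witness
    have hxry := eq_mul_of_of_eq_div (hInt (C.baseOp A)) (hr.symm.trans hdiv)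
    have hrΦ : r ∈ C.Φ.carrier A :=
      (isGroupSaturated_iff' _).1 (C.isGroupSaturated A) r x hx y hy hxry.symm
    have hr1' := ne_one_of_eq_mul_of_ne hxry hxy
    have hr1 : (⟨r, hrΦ⟩ : C.Φ.carrier A) ≠ 1 := fun h1 => hr1' (congrArg Subtype.val h1)
    exact C.exists_cnstFn_effective_of_divΛ_eq hb hr1 hr
  · -- `div(b) = r⁻¹` anti-effective: `y = r·x`, `r ∈ Φ(A)`, and a companion constant `b'` with `div(b') = r`
    have hyrx := eq_mul_of_of_inv_eq_div (hInt (C.baseOp A)) (hr.symm.trans hdiv)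
    have hrΦ : r ∈ C.Φ.carrier A :=
      (isGroupSaturated_iff' _).1 (C.isGroupSaturated A) r y hy x hx hyrx.symm
    have hr1' := ne_one_of_eq_mul_of_ne hyrx hxy.symm
    have hr1 : (⟨r, hrΦ⟩ : C.Φ.carrier A) ≠ 1 := fun h1 => hr1' (congrArg Subtype.val h1)
    obtain ⟨b', hb', hdiv'⟩ := hNeg _ b hb r hr
    exact C.exists_cnstFn_effective_of_divΛ_eq hb' hr1 hdiv'

/-- **Def. 3.6 (ii)(b), bracketed sentence, DERIVED** ("Thus, it follows from these conditions that for every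
`A ∈ Ob(D)`, the image of the homomorphism `F(A) → (Φ^{bs-fld})^gp(A)` contains a nonzero element of
`Φ^{bs-fld}(A)`", p.303 l.8–10) — the binder `hNZ` of `bsFldPreStepLimitCriterion_of` VERBATIM — from the typed
Def. 3.6 (ii) fields together with `hLine` (the constant line `ℝ·Φ₀^cnst(Y)` consists of effective and
anti-effective elements: `ℝ·div(ϖ_L)`, Prop. 3.4 (ii)), `hInt` (`Φ₀^ℝ(Y) ⊆ ∏_𝔭 ℝ_{≥0}` integral, [FrdI]
Def. 2.4 (i)) and `hP34Λ` (Prop. 3.4 (ii) second isomorphism at monoid type `Λ`, the binder of G-w5d124-1):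
in the anti-effective case the inverse `b⁻¹` of the constant (`B₀^Λ` is group-like, `isUnit_BΛ`) has the
effective divisor `r`, hence is constant by `hP34Λ`. [cite: MochizukiEtTh2009, Def 3.6 p.77] -/
theorem exists_cnstFn_effective_of_line
    (hLine : ∀ (Y : D₀ᵒᵖ) (g : Algebra.GrothendieckGroup (T.ΦR.obj Y)), g ∈ T.cnstR Y →
      ∃ r : T.ΦR.obj Y, g = Algebra.GrothendieckGroup.of r ∨ g = (Algebra.GrothendieckGroup.of r)⁻¹)
    (hInt : ∀ Y : D₀ᵒᵖ, IsCancelMul (T.ΦR.obj Y))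
    (hP34Λ : ∀ (Y : D₀ᵒᵖ) (b : T.BΛ.obj Y) (r : T.ΦR.obj Y),
      T.divΛ Y b = Algebra.GrothendieckGroup.of r → b ∈ T.FΛ Y)
    (A : Dᵒᵖ) :
    ∃ u : (T.BΛ.obj (C.baseOp A) : Type w) × Algebra.GrothendieckGroup (C.Φ.carrier A),
      u ∈ C.cnstFn A ∧ ∃ Z : C.Φ.carrier A, Z ≠ 1 ∧ u.2 = Algebra.GrothendieckGroup.of Z := by
  refine C.exists_cnstFn_effective_of_line_aux hLine hInt (fun Y b _ r hr => ?_) A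
  -- `b⁻¹` exists (`B₀^Λ(Y)` group-like) and has divisor `r`
  obtain ⟨b', hb'⟩ := (T.isUnit_BΛ Y b).exists_left_inv
  have hdiv' : T.divΛ Y b' = Algebra.GrothendieckGroup.of r := by
    have h1 : T.divΛ Y b' * T.divΛ Y b = 1 := by rw [← map_mul, hb', map_one]
    rw [eq_inv_of_mul_eq_one_left h1, hr, inv_inv]
  exact ⟨b', hP34Λ Y b' r hdiv', hdiv'⟩

/-- The same derivation with the third input replaced by inverse-closure of `F₀^Λ(Y)` (print: `F₀(Y) ≅ L^×`,
`F₀^ℚ = F₀^pf`, `F₀^ℝ = ℝ·Φ₀^cnst` are GROUPS, Prop. 3.4 (ii) / Def. 3.6 (i), pp.300, 302) instead of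
`hP34Λ`. [cite: MochizukiEtTh2009, Def 3.6 p.77] -/
theorem exists_cnstFn_effective_of_line_of_inv
    (hLine : ∀ (Y : D₀ᵒᵖ) (g : Algebra.GrothendieckGroup (T.ΦR.obj Y)), g ∈ T.cnstR Y →
      ∃ r : T.ΦR.obj Y, g = Algebra.GrothendieckGroup.of r ∨ g = (Algebra.GrothendieckGroup.of r)⁻¹)
    (hInt : ∀ Y : D₀ᵒᵖ, IsCancelMul (T.ΦR.obj Y))
    (hFinv : ∀ (Y : D₀ᵒᵖ) (b : T.BΛ.obj Y), b ∈ T.FΛ Y → ∃ b' ∈ T.FΛ Y, b' * b = 1)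
    (A : Dᵒᵖ) :
    ∃ u : (T.BΛ.obj (C.baseOp A) : Type w) × Algebra.GrothendieckGroup (C.Φ.carrier A),
      u ∈ C.cnstFn A ∧ ∃ Z : C.Φ.carrier A, Z ≠ 1 ∧ u.2 = Algebra.GrothendieckGroup.of Z := by
  refine C.exists_cnstFn_effective_of_line_aux hLine hInt (fun Y b hb r hr => ?_) A
  obtain ⟨b', hb'F, hb'⟩ := hFinv Y b hb
  have hdiv' : T.divΛ Y b' = Algebra.GrothendieckGroup.of r := by
    have h1 : T.divΛ Y b' * T.divΛ Y b = 1 := by rw [← map_mul, hb', map_one]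
    rw [eq_inv_of_mul_eq_one_left h1, hr, inv_inv]
  exact ⟨b', hb'F, hdiv'⟩

/-- Conversely (bookkeeping, no hypotheses): an `hNZ`-witness at `A` yields a nonzero EFFECTIVE element of the
constant line, `of(Z) ∈ ℝ·Φ₀^cnst(Y_A)` with `Z ∈ Φ^{bs-fld}(A)`, `Z ≠ 1` — so `hNZ` is exactly the statement
that the image of `F(A)` meets `Φ^{bs-fld}(A) ∖ {1}` ("contains a nonzero element of `Φ^{bs-fld}(A)`", p.303).
[cite: MochizukiEtTh2009, Def 3.6 p.77] -/
theorem exists_bsFld_ne_one_of_cnstFn {A : Dᵒᵖ}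
    (h : ∃ u : (T.BΛ.obj (C.baseOp A) : Type w) × Algebra.GrothendieckGroup (C.Φ.carrier A),
      u ∈ C.cnstFn A ∧ ∃ Z : C.Φ.carrier A, Z ≠ 1 ∧ u.2 = Algebra.GrothendieckGroup.of Z) :
    ∃ Z : C.Φ.carrier A, Z ≠ 1 ∧ C.IsBaseFieldTheoreticDiv Z ∧
      ∃ b ∈ T.FΛ (C.baseOp A), T.divΛ _ b = Algebra.GrothendieckGroup.of (Z : C.ΦRlog.obj A) := by
  obtain ⟨u, hu, Z, hZ1, hZ⟩ := h
  refine ⟨Z, hZ1, isBaseFieldTheoreticDiv_of_cnstFn hu hZ, u.1, (Submonoid.mem_inf.1 hu).2, ?_⟩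
  have h1 : T.divΛ (C.baseOp A) u.1 = C.ΦgpToRlog A u.2 := (Submonoid.mem_inf.1 hu).1
  rw [h1, hZ, ΦgpToRlog, gpMap_of]
  rfl

/-! ### §3 Row C38-L05 re-exported with a binder list of DATA properties only -/

/-- **Row C38-L05 of the [EtTh] Cor. 3.8 sub-DAG, `hNZ` discharged** (proof of Cor. 3.8, PDF p.81 l.20–27):
abc-iut-w5-d124's `bsFldPreStepLimitCriterion_of` with its binder `hNZ` (Def. 3.6 (ii)(b) bracketed sentence)
supplied by `exists_cnstFn_effective_of_line`; the remaining binders `hP34Λ` (Prop. 3.4 (ii) at monoid type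
`Λ`), `hLine` (the constant line is totally ordered by effectivity), `hInt` (`Φ₀^ℝ` integral) and `hSup`
(suprema along the constant line) are properties of the data of Def. 3.3 (iii) / 3.6 (i) ALONE, not of the
tempered Frobenioid. [cite: MochizukiEtTh2009, Cor 3.8 p.81] -/
theorem bsFldPreStepLimitCriterion_of_line (hF : PreFrobenioid.IsFrobenioid C.toElem)
    (hP34Λ : ∀ (Y : D₀ᵒᵖ) (b : T.BΛ.obj Y) (r : T.ΦR.obj Y),
      T.divΛ Y b = Algebra.GrothendieckGroup.of r → b ∈ T.FΛ Y)
    (hLine : ∀ (Y : D₀ᵒᵖ) (g : Algebra.GrothendieckGroup (T.ΦR.obj Y)), g ∈ T.cnstR Y →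
      ∃ r : T.ΦR.obj Y, g = Algebra.GrothendieckGroup.of r ∨ g = (Algebra.GrothendieckGroup.of r)⁻¹)
    (hInt : ∀ Y : D₀ᵒᵖ, IsCancelMul (T.ΦR.obj Y))
    (hSup : ∀ (W : D) (m : Perfection (C.divisorMonoid.obj (op W)))
      (U : Set (Perfection (C.divisorMonoid.obj (op W)))),
      U ⊆ C.bsFldPf W → U.Nonempty → (∀ u ∈ U, u ∣ m) → ∃ y ∈ C.bsFldPf W, (∀ u ∈ U, u ∣ y) ∧ y ∣ m) :
    C.BsFldPreStepLimitCriterion (PreFrobenioidData.perfection hF) :=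
  C.bsFldPreStepLimitCriterion_of hF hP34Λ (C.exists_cnstFn_effective_of_line hLine hInt hP34Λ) hSup

end TemperedFrobenioid

end Literature.AnabelianGeometry.EtaleTheta
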